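import Summits.ResolutionOfSingularities.ResolutionOfSingularities.Theses.JacobianBudget

/-!
# Route JacobianBudget — `JacobianDropToTermination` (item stmt-ResolutionOfSingularities-18947)

Weak duality for the Jacobian budget: if along the point-blow-up dynamics the Jacobian colength
`μ` drops by at least `Δ_n(p) = ((p-1)^n (p+1) + 1 - 2·((n+1) mod 2)) / p` at every pair of
consecutive isolated multiplicity-`p` states (`IsolatedJacobianDrop`), then no run has all of its
states isolated of multiplicity `p` (`IsolatedForcedTermination`): `Δ_n(p) ≥ 1` for `p ≥ 2`,
and an `ℕ`-valued quantity cannot drop by `≥ 1` infinitely often.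

The two route definitions share their `let`-telescope verbatim (the coefficient calculus
`clean / bl / ord / dv / tr / step / run / ser / pd / jac / Isol / MultP`), so after introducing the
telescope of the conclusion as local definitions the hypothesis specialises to the same data by
definitional unfolding; what remains is order bookkeeping on `ℕ`.
-/

-- single-problem summit: the doubled namespace component `ResolutionOfSingularities` is forced
set_option linter.dupNamespace false

namespace Summit.ResolutionOfSingularities.ResolutionOfSingularities.Theorems

open Summit.ResolutionOfSingularities.ResolutionOfSingularities.Theses.JacobianBudget

/-- The universal decrement `Δ_n(p) = ((p-1)^n (p+1) + 1 - 2·((n+1) mod 2)) / p` is at least `1`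
as soon as `p ≥ 2` (for every `n`): the numerator is `≥ (p+1) + 1 - 2 = p`. -/
theorem jacobianBudget_one_le_delta {p : ℕ} (n : ℕ) (hp : 2 ≤ p) :
    1 ≤ ((p - 1) ^ n * (p + 1) + 1 - 2 * ((n + 1) % 2)) / p := by
  have h1 : 1 ≤ (p - 1) ^ n := Nat.one_le_pow _ _ (by omega)
  have h2 : 1 * (p + 1) ≤ (p - 1) ^ n * (p + 1) := Nat.mul_le_mul_right (p + 1) h1
  rw [Nat.le_div_iff_mul_le (by omega)]
  omega

/-- No infinite descent in `ℕ`: there is no sequence `f : ℕ → ℕ` with `f (m+1) + Δ ≤ f m` for all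
`m` when `Δ ≥ 1`. -/
theorem jacobianBudget_false_of_forall_succ_add_le (f : ℕ → ℕ) (Δ : ℕ) (hΔ : 1 ≤ Δ)
    (h : ∀ m, f (m + 1) + Δ ≤ f m) : False := by
  have key : ∀ m, f m + m ≤ f 0 := by
    intro m
    induction m with
    | zero => simp
    | succ k ih => have := h k; omega
  have := key (f 0 + 1)
  omega

/-- **Weak duality for the Jacobian budget** (item stmt-ResolutionOfSingularities-18947, route
JacobianBudget): `IsolatedJacobianDrop → IsolatedForcedTermination`. Along a run all of whose
states are isolated of multiplicity `p`, `IsolatedJacobianDrop` makes the `ℕ`-valued Jacobian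
colength `μ` of the stages drop by `Δ_n(p) ≥ 1` at every step, which is impossible. -/
theorem jacobianDropToTermination_proof :
    Summit.ResolutionOfSingularities.ResolutionOfSingularities.Theses.JacobianBudget.JacobianDropToTermination := by
  unfold JacobianDropToTermination
  -- the hypothesis, the data `p, n, κ, c₀, i, t`, the shared `let`-telescope, and the infinite run
  intro hdrop p hp n hn κ _ _ _ c₀ i t clean bl ord dv tr step run ser pd jac Isol MultP hall
  have h := hdrop p hp n hn κ c₀ i t
  have key : ∀ m, Module.finrank κ (MvPowerSeries (Fin n) κ ⧸ jac (run c₀ i t (m + 1))) +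
      ((p - 1) ^ n * (p + 1) + 1 - 2 * ((n + 1) % 2)) / p ≤
      Module.finrank κ (MvPowerSeries (Fin n) κ ⧸ jac (run c₀ i t m)) :=
    fun m => h m (hall m).1 (hall m).2 (hall (m + 1)).1 (hall (m + 1)).2
  exact jacobianBudget_false_of_forall_succ_add_le
    (fun m => Module.finrank κ (MvPowerSeries (Fin n) κ ⧸ jac (run c₀ i t m))) _
    (jacobianBudget_one_le_delta n hp.two_le) key

end Summit.ResolutionOfSingularities.ResolutionOfSingularities.Theorems
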